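import Summits.QuantumFields.YangMills.Theorems.UnitScaleTiltProp7AxialReprPrint
import Literature.MathematicalPhysics.QuantumFieldTheory.Balaban1983to89.B8Eq131Cubes
import HarnessLib

/-!
# `UnitScaleTiltProp7AxialResidualFreedom` — THE RESIDUAL FREEDOM OF THE AXIAL GAUGE `Ax_k(𝔅_k, U₀)` (1.19) AND THE AXIAL GAUGE FIXING WITH
# PRESCRIBED VALUES AT THE `k`-CENTRES (route `UnitScaleTilt`, crux K1 «MinimiserStabilityRegPr» stmt-QuantumFields-19200, stub EX `stub_existenceMinimalOrbit`,
# route (α), node (α-S) = OWNER RULING g26-№19 «explicit witness `ũ_S`»; def-free, count-neutral, `--supports stmt-QuantumFields-19200 --as helper`)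

Cell `ym3-torus` ∕ width seat `ym-ust-20520-w5` (gen 4).  YM₃ on T³ is ladder rung R3 (HUMAN RULING D-0037) — not d = 4, not a mass gap, not the Clay problem; nothing
here is a claim about the stub, the crux or the gap.

THE PRINT.  [Balaban1985RegularSpaces] p. 79, after (1.19)–(1.20): «The conditions (1.19) determine uniquely an element in each orbit given by the subgroup (1.14)»
— the subgroup of gauge transformations with `u(y) = 1` for `y ∈ 𝔅_k` (the `k`-centres).  Equivalently: the FULL gauge group acts on `Ax_k(𝔅_k, U₀)` through its
values at the `k`-centres, and for EVERY prescription `c : Λ_k → G` of those values there is exactly one `u` with `u|_{Λ_k} = c` carrying a given `U` into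
`Ax_k(𝔅_k, U₀)`.  The tree certifies the PINNED case `c ≡ 1` ([Balaban1985RegularSpaces] (1.14); `B8Eq166ConstraintPair.pinnedTwistedFix_global` on `ℤᵈ`,
`Prop7AxialReprPrint.exists_repr_inAx_based` at the setup torus) and the residual freedom by ONE constant (`B8Eq119TwistedAxial.twistedFix_conjConst_mul`).
This file certifies the GENERAL prescription: the residual freedom is the group of `U₀`-COVARIANTLY-CONSTANT-PER-TOP-BLOCK transformations
`g_C := v₀⁻¹·C·v₀` (`v₀ = pinnedGauge L U₀ k` the pinned tower gauge of the background, [Balaban1985RegularSpaces] (1.15)∕p. 98; `C` constant on every top block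
`Lᵏz + [0, Lᵏ)ᵈ`), and `u_c := g_{c∘⌊·∕Lᵏ⌋} · ptw L U₀ U k` is the axial gauge fixing of `U` relative to `U₀` with `u_c(Lᵏz) = c(z)`.

WHY (cell DEPMAP).  The EX display's (20)-clause was re-based by RULING g26-№19 to the SYMMETRIC slice `Prop7SPrint.AvgCondPrintS` whose witness `ũ_S` is normalised by
(1.19) (axial below the top w.r.t. `U₀`) and by PRESCRIBED top-centre values `(frameTwS U₀ (iX) ·)⁻¹` (`Prop7SPrint.NormS`) instead of print's (1.29).  The sibling file
`…Prop7SymSliceWitness` reads this file at the T³ carrier and produces `∃ u, NormS … u`.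

WHAT IS PROVED (sorry-free, no definition; `ℤᵈ` carriers of `B7Prop1Explicit`∕`B7Prop2Explicit`, `Ūʲ = avgIter L U j`, block contours `Γ_{Lz,x}`, `x = Lz + r`):
* §1 floors by powers of `L` (`B8Eq131Cubes.flm`): `flm_succ_eq_flm_fl`, `flm_add_pow_smul`, `flm_pow_smul_self` (`⌊Lᵏz∕Lᵏ⌋ = z`), ★`flm_pow_smul_block` (both ends of a
  level-`j` block contour, read on the fine lattice, lie in the same top block, `j + 1 ≤ k`), `flm_add_mul_pow_smul` (periods `N·Lᵏ` shift the top block by `N`).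
* §2 ★★`conjFreedom_global` — for an `AvgClosed` group `G`, `G`-valued small fields `U₀`, `W` (Prop. 1∕2 windows of [Balaban1985Averaging]) with `W` in the axial gauge
  (1.19) relative to `U₀` between ALL consecutive levels, and any `G`-valued `C` constant on top blocks along block contours: `g_C = v₀⁻¹Cv₀` is `G`-valued, keeps the
  plaquette deviation, has top values `g_C(Lᵏz) = C(Lᵏz)`, and `W^{g_C}` is again in the axial gauge (1.19) relative to `U₀` between all consecutive levels (covariance
  p. 78 «(\overline{U^u}ʲ)_b = (Ūʲ)ᵘ_b», `B7AvgGaugeCovariance.avgIter_gaugeAct`, + the (1.15)-identity `Ū₀ʲ(Γ_{Lz,x}) = v₀(Lʲ·Lz)⁻¹v₀(Lʲx)` of the pinned gauge);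
  `conjFreedom_periodic`; ★★`topData_global` — `u_c := g_{c∘flm L k}·ptw L U₀ W k` is `G`-valued, `u_c(Lᵏz) = c z`, `W^{u_c}` axial (1.19) rel. `U₀` globally;
  `topData_periodic` — `u_c` is `N·Lᵏ`-periodic for `N·Lᵏ`-periodic `U₀`, `W` and `N`-periodic `c` (the torus case, [Balaban1985RegularSpaces] (1.3)).
* §3 setup torus (`P : Params`, `SU(N)`, `N ≤ 21`, based pullbacks at `x₀ = embIter k 0`): ★★★`exists_gauge_topData_global` ∕ `exists_gauge_topData_inAx` — for torus
  configurations `U₀`, `W` with `pdev ·♯ < α·L^{−2k}` (`C₀α ≤ ⅓`, `2α ≤ c₂′`) and EVERY `c : Site P k → SU(N)` there is an `SU(N)` gauge transformation `u` with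
  `u (embIter k y) = c y` at every `k`-centre and `(W^u)♯ ∈ Ax_k(ℭ, U₀♯)` for every family `ℭ` (descent of the periodic `u_c` by `Prop7AxialReprPrint.exists_su_gauge_of_periodic`).
HONEST SCOPE.  Pure gauge algebra on top of the tree's certified covariance of the comb averages (43) inside their analyticity domain; no estimate beyond the displayed
Prop. 1∕2 windows; nothing of [Balaban1985RegularSpaces] Theorem 4 ∕ (1.29) is used or asserted.  `--supports stmt-QuantumFields-19200 --as helper`.

References: T. Bałaban, CMP **99** (1985) 75–102 [Balaban1985RegularSpaces] ((1.3) p.77, (1.13)–(1.15) p.78, (1.19)–(1.20) p.79, p.98); CMP **98** (1985) 17–51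
[Balaban1985Averaging] ((8), (11) p.19, (42)–(43) pp.23–24, Prop. 2 (52)–(54) p.26, (78)–(81) p.30); CMP **102** (1985) 277–309 [Balaban1985Variational] ((4) p.278, (18)–(20) pp.280–281).
-/

set_option autoImplicit false

noncomputable section

namespace Summit.QuantumFields.YangMills.Theorems.Prop7AxialResidualFreedom

open NormedSpace
open Literature.MathematicalPhysics.QuantumFieldTheory.Balaban1983to89
open B7Prop1Explicit renaming Site → LSite
open B7Prop1Explicit (gaugeAct axialFn boxVec e U1)
open B7Prop2Explicit (avgIter pdev C0 c2' AvgClosed)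
open B7AvgGaugeCovariance (uLev uLev_apply avgIter_gaugeAct pdev_gaugeAct)
open B8Ineq130 (fl)
open B8Eq115GaugeFixing (gaugeAct_mul gaugeAct_mem_of axialFn_gaugeAct fl_smul fl_block)
open B8Eq119TwistedAxial (InAx inAx_of_global eq_inv_mul_of_conj_eq_one)
open B8Eq166ConstraintPair (pinnedGauge pinnedGauge_top pinnedGauge_periodic pinnedFix_global ptw ptw_top ptw_periodic
  pinnedTwistedFix_global)
open B8Eq131Cubes (flm)
open B12Ineq417Flat (shiftCfg shiftCfg_apply)

variable {d : ℕ}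

/-! ## §1 `ℤᵈ`: floors by powers of `L` (the top block of a point) -/

section Floors

/-- `⌊x∕L^{n+1}⌋ = ⌊⌊x∕L⌋∕Lⁿ⌋` componentwise: the `(n+1)`-fold block of `x` is the `n`-fold block of its block `fl L x`. [cite: Balaban1985RegularSpaces, (1.12) p.78] -/
theorem flm_succ_eq_flm_fl {L : ℕ} (hL : 1 ≤ L) (n : ℕ) (x : LSite d) : flm L (n + 1) x = flm L n (fl L x) := by
  funext i
  simp only [flm, fl]
  rw [pow_succ', ← Int.ediv_ediv_of_nonneg (by positivity)]

/-- `flm L 0 = id`. [cite: Balaban1985RegularSpaces, (1.12) p.78] -/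
theorem flm_zero (L : ℕ) (x : LSite d) : flm L 0 x = x := by
  funext i
  simp [flm]

/-- `⌊Lʲx∕L^{j+n}⌋ = ⌊x∕Lⁿ⌋`: dilating by `Lʲ` and descending `j + n` levels is descending `n` levels. [cite: Balaban1985RegularSpaces, (1.12) p.78] -/
theorem flm_add_pow_smul {L : ℕ} (hL : 1 ≤ L) (n : ℕ) : ∀ (j : ℕ) (x : LSite d), flm L (j + n) (((L : ℤ) ^ j) • x) = flm L n x
  | 0, x => by rw [zero_add, pow_zero, one_smul]
  | j + 1, x => by
    rw [show j + 1 + n = (j + n) + 1 by omega, flm_succ_eq_flm_fl hL, pow_succ', mul_smul, fl_smul hL]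
    exact flm_add_pow_smul hL n j x

/-- `⌊Lᵏz∕Lᵏ⌋ = z`: the top block of the `k`-centre `Lᵏz` is indexed by `z`. [cite: Balaban1985RegularSpaces, (1.12)–(1.14) p.78] -/
theorem flm_pow_smul_self {L : ℕ} (hL : 1 ≤ L) (k : ℕ) (z : LSite d) : flm L k (((L : ℤ) ^ k) • z) = z := by
  have h := flm_add_pow_smul hL 0 k z
  rwa [add_zero, flm_zero] at h

/-- ★ **BOTH ENDS OF A BLOCK CONTOUR LIE IN ONE TOP BLOCK**: for `j + 1 + n = k`, the fine-lattice readings `Lʲ·(Lz)` and `Lʲ·(Lz + r)`, `r ∈ [0, L)ᵈ`, of the two ends of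
the level-`j` block contour `Γ_{Lz, Lz+r}` have the same `Lᵏ`-block (namely `⌊z∕Lⁿ⌋`) — the geometric fact behind the residual freedom of (1.19): a function constant on top
blocks takes equal values at the two ends of every contour that (1.19) constrains. [cite: Balaban1985RegularSpaces, (1.19) p.79, (1.12) p.78] -/
theorem flm_pow_smul_block {L : ℕ} (hL : 1 ≤ L) {j n k : ℕ} (hk : j + 1 + n = k) (z : LSite d) (r : Fin d → Fin L) :
    flm L k (((L : ℤ) ^ j) • ((L : ℤ) • z + boxVec L r)) = flm L k (((L : ℤ) ^ j) • ((L : ℤ) • z)) := by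
  subst hk
  rw [show j + 1 + n = j + (n + 1) by omega, flm_add_pow_smul hL, flm_add_pow_smul hL, flm_succ_eq_flm_fl hL,
    flm_succ_eq_flm_fl hL, fl_block hL, fl_smul hL]

/-- Shifting by a period `N·Lᵏ·e_i` shifts the top block by `N·e_i` (the torus of [Balaban1985RegularSpaces] (1.3) read on `ℤᵈ`). [cite: Balaban1985RegularSpaces, (1.3) p.77] -/
theorem flm_add_mul_pow_smul {L : ℕ} (hL : 1 ≤ L) (k : ℕ) (N : ℕ) (x : LSite d) (i : Fin d) :
    flm L k (x + ((N * L ^ k : ℕ) : ℤ) • e i) = flm L k x + (N : ℤ) • e i := by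
  funext μ
  have hLk : (0 : ℤ) < (L : ℤ) ^ k := by positivity
  simp only [flm, Pi.add_apply, Pi.smul_apply, smul_eq_mul]
  push_cast
  rw [show x μ + (N : ℤ) * (L : ℤ) ^ k * e i μ = x μ + ((N : ℤ) * e i μ) * (L : ℤ) ^ k by ring,
    Int.add_mul_ediv_right _ _ hLk.ne']

end Floors

/-! ## §2 `ℤᵈ`: the residual freedom of `Ax_k(𝔅_k, U₀)` -/

section Zd

variable {𝔸 : Type*} [NormedRing 𝔸] [NormOneClass 𝔸] [NormedAlgebra ℂ 𝔸] [CompleteSpace 𝔸]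

/-- ★★ **THE RESIDUAL FREEDOM OF `Ax_k(𝔅_k, U₀)`, GLOBAL CARRIER** ([Balaban1985RegularSpaces] p. 79 «The conditions (1.19) determine uniquely an element in each orbit
given by the subgroup (1.14)» — its converse half: what the transformations NOT in the subgroup (1.14) do).  Let `G` be `AvgClosed`, `L ≥ 2`, `U₀`, `W` `G`-valued with
`sup_p |·(∂p) − 1| < α·L^{−2k}`, `α` Prop.-1∕2-small, `W` in the axial gauge (1.19) relative to `U₀` between ALL consecutive levels (`W̄ʲ(Γ_{Lz,x}) = Ū₀ʲ(Γ_{Lz,x})`), and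
let `C : ℤᵈ → G` take equal values at the fine readings of the two ends of every block contour below the top (`hC`; e.g. `C = c ∘ flm L k`, `flm_pow_smul_block`).  Then
`g_C := v₀⁻¹·C·v₀`, `v₀ = pinnedGauge L U₀ k` ((1.15) for the background, `= 1` on `Lᵏℤᵈ`), is `G`-valued, `W^{g_C}` is `G`-valued with the same plaquette deviation,
`g_C(Lᵏz) = C(Lᵏz)`, and `W^{g_C}` is AGAIN in the axial gauge (1.19) relative to `U₀` between all consecutive levels.  Proof: covariance p. 78
«(\overline{U^u}ʲ)_b = (Ūʲ)ᵘ_b» (`avgIter_gaugeAct`) and the pinned-gauge identity `Ū₀ʲ(Γ_{Lz,x}) = v₀(Lʲ·Lz)⁻¹·v₀(Lʲ·x)` ((1.15) for `U₀^{v₀}`); for ONE constant `C` this is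
`B8Eq119TwistedAxial.twistedFix_conjConst_mul`. [cite: Balaban1985RegularSpaces, (1.19) p.79, (1.14)–(1.15) p.78, p.78 (covariance); Balaban1985Averaging, (8), (11) p.19] -/
theorem conjFreedom_global (L : ℕ) (hL : 2 ≤ L) {G : Subgroup 𝔸ˣ} (hG : AvgClosed d L G) (k : ℕ)
    (U₀ W : LSite d → Fin d → 𝔸ˣ) (hU₀ : ∀ x κ, U₀ x κ ∈ G) (hW : ∀ x κ, W x κ ∈ G) {α : ℝ} (hα : 0 < α)
    (hα3 : C0 d * α ≤ 1 / 3) (hα2 : 2 * α ≤ c2' d L)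
    (h33 : pdev U₀ < α * (((L : ℝ) ^ k)⁻¹) ^ 2) (h34 : pdev W < α * (((L : ℝ) ^ k)⁻¹) ^ 2)
    (C : LSite d → 𝔸ˣ) (hCG : ∀ x, C x ∈ G)
    (hC : ∀ (j n : ℕ) (z : LSite d) (r : Fin d → Fin L), j + 1 + n = k →
      C (((L : ℤ) ^ j) • ((L : ℤ) • z + boxVec L r)) = C (((L : ℤ) ^ j) • ((L : ℤ) • z)))
    (h19 : ∀ n, n < k → ∀ (z : LSite d) (r : Fin d → Fin L),
      axialFn (avgIter L W (k - (n + 1))) ((L : ℤ) • z) ((L : ℤ) • z + boxVec L r) =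
        axialFn (avgIter L U₀ (k - (n + 1))) ((L : ℤ) • z) ((L : ℤ) • z + boxVec L r)) :
    (∀ x, ((pinnedGauge L U₀ k)⁻¹ * C * pinnedGauge L U₀ k) x ∈ G) ∧
    (∀ x κ, gaugeAct ((pinnedGauge L U₀ k)⁻¹ * C * pinnedGauge L U₀ k) W x κ ∈ G) ∧
    pdev (gaugeAct ((pinnedGauge L U₀ k)⁻¹ * C * pinnedGauge L U₀ k) W) = pdev W ∧
    (∀ z : LSite d, ((pinnedGauge L U₀ k)⁻¹ * C * pinnedGauge L U₀ k) (((L : ℤ) ^ k) • z) = C (((L : ℤ) ^ k) • z)) ∧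
    (∀ n, n < k → ∀ (z : LSite d) (r : Fin d → Fin L),
      axialFn (avgIter L (gaugeAct ((pinnedGauge L U₀ k)⁻¹ * C * pinnedGauge L U₀ k) W) (k - (n + 1))) ((L : ℤ) • z)
          ((L : ℤ) • z + boxVec L r) =
        axialFn (avgIter L U₀ (k - (n + 1))) ((L : ℤ) • z) ((L : ℤ) • z + boxVec L r)) := by
  have hL1 : 1 ≤ L := le_trans (by norm_num) hL
  obtain ⟨hv₀G, -, -, hcov₀, h15₀, htop₀, -⟩ := pinnedFix_global L hL hG k U₀ hU₀ hα hα3 hα2 h33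
  have hg_apply : ∀ x, ((pinnedGauge L U₀ k)⁻¹ * C * pinnedGauge L U₀ k) x = (pinnedGauge L U₀ k x)⁻¹ * C x * pinnedGauge L U₀ k x :=
    fun x => rfl
  have hgG : ∀ x, ((pinnedGauge L U₀ k)⁻¹ * C * pinnedGauge L U₀ k) x ∈ G := fun x =>
    G.mul_mem (G.mul_mem (G.inv_mem (hv₀G x)) (hCG x)) (hv₀G x)
  have hgU : ∀ x, ((pinnedGauge L U₀ k)⁻¹ * C * pinnedGauge L U₀ k) x ∈ U1 𝔸 := fun x => hG.le_U1 (hgG x)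
  have hcov : ∀ j ≤ k, avgIter L (gaugeAct ((pinnedGauge L U₀ k)⁻¹ * C * pinnedGauge L U₀ k) W) j =
      gaugeAct (uLev L ((pinnedGauge L U₀ k)⁻¹ * C * pinnedGauge L U₀ k) j) (avgIter L W j) :=
    avgIter_gaugeAct L hL hG k W hW hgU hα hα3 hα2 h34
  refine ⟨hgG, gaugeAct_mem_of hW hgG, pdev_gaugeAct hgU W, fun z => ?_, fun n hn z r => ?_⟩
  · rw [hg_apply, pinnedGauge_top hL1, inv_one, one_mul, mul_one]
  · have e₀ := h15₀ n hn z r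
    rw [hcov₀ _ (by omega), axialFn_gaugeAct] at e₀
    have hA := eq_inv_mul_of_conj_eq_one e₀
    rw [hcov _ (by omega), axialFn_gaugeAct, h19 n hn z r, hA]
    simp only [uLev_apply, hg_apply]
    rw [hC (k - (n + 1)) n z r (by omega)]
    group

omit [NormOneClass 𝔸] in
/-- `g_C = v₀⁻¹Cv₀` is `N·Lᵏ`-periodic for `N·Lᵏ`-periodic `U₀` and `C` (the torus case, `pinnedGauge_periodic`). [cite: Balaban1985RegularSpaces, (1.3) p.77, (1.15) p.78] -/
theorem conjFreedom_periodic {L : ℕ} (hL : 1 ≤ L) (N k : ℕ) {U₀ : LSite d → Fin d → 𝔸ˣ}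
    (hU₀ : ∀ i : Fin d, shiftCfg (((N * L ^ k : ℕ) : ℤ) • e i) U₀ = U₀)
    {C : LSite d → 𝔸ˣ} (hCper : ∀ (x : LSite d) (i : Fin d), C (x + ((N * L ^ k : ℕ) : ℤ) • e i) = C x)
    (x : LSite d) (i : Fin d) :
    ((pinnedGauge L U₀ k)⁻¹ * C * pinnedGauge L U₀ k) (x + ((N * L ^ k : ℕ) : ℤ) • e i) =
      ((pinnedGauge L U₀ k)⁻¹ * C * pinnedGauge L U₀ k) x := by
  simp only [Pi.mul_apply, Pi.inv_apply]
  rw [pinnedGauge_periodic hL N k hU₀, hCper]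

/-- ★★ **THE AXIAL GAUGE FIXING (1.19) WITH PRESCRIBED TOP-CENTRE VALUES, GLOBAL CARRIER**: for `G` `AvgClosed`, `L ≥ 2`, `U₀`, `W` `G`-valued with
`sup_p |·(∂p) − 1| < α·L^{−2k}` (`C₀α ≤ ⅓`, `2α ≤ c₂′`) and ANY top datum `c : ℤᵈ → G`, the transformation `u_c := (v₀⁻¹·(c ∘ flm L k)·v₀)·ptw L U₀ W k` (pinned twisted fix of
`B8Eq166ConstraintPair`, then the residual freedom of `conjFreedom_global`) is `G`-valued, `W^{u_c}` is `G`-valued, **`u_c(Lᵏz) = c z`** for every `z`, and `W^{u_c}` is in the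
axial gauge (1.19) relative to `U₀` between ALL consecutive levels at every block (`\overline{W^{u_c}}ʲ(Γ_{Lz,x}) = Ū₀ʲ(Γ_{Lz,x})`).  (For `c ≡ 1` this is `pinnedTwistedFix_global`.)
[cite: Balaban1985RegularSpaces, (1.19) p.79, p.79 (sentence after (1.20)), (1.14)–(1.15) p.78] -/
theorem topData_global (L : ℕ) (hL : 2 ≤ L) {G : Subgroup 𝔸ˣ} (hG : AvgClosed d L G) (k : ℕ)
    (U₀ W : LSite d → Fin d → 𝔸ˣ) (hU₀ : ∀ x κ, U₀ x κ ∈ G) (hW : ∀ x κ, W x κ ∈ G) {α : ℝ} (hα : 0 < α)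
    (hα3 : C0 d * α ≤ 1 / 3) (hα2 : 2 * α ≤ c2' d L)
    (h33 : pdev U₀ < α * (((L : ℝ) ^ k)⁻¹) ^ 2) (h34 : pdev W < α * (((L : ℝ) ^ k)⁻¹) ^ 2)
    (c : LSite d → 𝔸ˣ) (hcG : ∀ z, c z ∈ G) :
    (∀ x, (((pinnedGauge L U₀ k)⁻¹ * (fun x => c (flm L k x)) * pinnedGauge L U₀ k) * ptw L U₀ W k) x ∈ G) ∧
    (∀ x κ, gaugeAct (((pinnedGauge L U₀ k)⁻¹ * (fun x => c (flm L k x)) * pinnedGauge L U₀ k) * ptw L U₀ W k) W x κ ∈ G) ∧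
    (∀ z : LSite d, (((pinnedGauge L U₀ k)⁻¹ * (fun x => c (flm L k x)) * pinnedGauge L U₀ k) * ptw L U₀ W k) (((L : ℤ) ^ k) • z) = c z) ∧
    (∀ n, n < k → ∀ (z : LSite d) (r : Fin d → Fin L),
      axialFn (avgIter L (gaugeAct (((pinnedGauge L U₀ k)⁻¹ * (fun x => c (flm L k x)) * pinnedGauge L U₀ k) * ptw L U₀ W k) W)
          (k - (n + 1))) ((L : ℤ) • z) ((L : ℤ) • z + boxVec L r) =
        axialFn (avgIter L U₀ (k - (n + 1))) ((L : ℤ) • z) ((L : ℤ) • z + boxVec L r)) := by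
  have hL1 : 1 ≤ L := le_trans (by norm_num) hL
  obtain ⟨huG, hWuG, hpdev, htop, h19, -⟩ := pinnedTwistedFix_global L hL hG k U₀ W hU₀ hW hα hα3 hα2 h33 h34
  have h34' : pdev (gaugeAct (ptw L U₀ W k) W) < α * (((L : ℝ) ^ k)⁻¹) ^ 2 := by rw [hpdev]; exact h34
  have hC : ∀ (j n : ℕ) (z : LSite d) (r : Fin d → Fin L), j + 1 + n = k →
      (fun x => c (flm L k x)) (((L : ℤ) ^ j) • ((L : ℤ) • z + boxVec L r)) = (fun x => c (flm L k x)) (((L : ℤ) ^ j) • ((L : ℤ) • z)) :=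
    fun j n z r hk => by simp only [flm_pow_smul_block hL1 hk]
  obtain ⟨hgG, hgWG, -, hgtop, hg19⟩ := conjFreedom_global L hL hG k U₀ (gaugeAct (ptw L U₀ W k) W) hU₀ hWuG hα hα3 hα2 h33 h34'
    (fun x => c (flm L k x)) (fun x => hcG _) hC h19
  refine ⟨fun x => G.mul_mem (hgG x) (huG x), fun x κ => ?_, fun z => ?_, fun n hn z r => ?_⟩
  · rw [gaugeAct_mul]; exact hgWG x κ
  · rw [Pi.mul_apply, htop z, mul_one, hgtop z]
    simp only [flm_pow_smul_self hL1]
  · rw [gaugeAct_mul]; exact hg19 n hn z r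

omit [NormOneClass 𝔸] in
/-- `u_c` is `N·Lᵏ`-periodic when `U₀`, `W` are `N·Lᵏ`-periodic and the top datum `c` is `N`-periodic — the gauge fixing of configurations on the torus `T_η` read on `ℤᵈ`
(`ptw_periodic`, `conjFreedom_periodic`, `flm_add_mul_pow_smul`). [cite: Balaban1985RegularSpaces, (1.3) p.77, (1.19) p.79] -/
theorem topData_periodic {L : ℕ} (hL : 1 ≤ L) (N k : ℕ) {U₀ W : LSite d → Fin d → 𝔸ˣ}
    (hU₀ : ∀ i : Fin d, shiftCfg (((N * L ^ k : ℕ) : ℤ) • e i) U₀ = U₀)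
    (hW : ∀ i : Fin d, shiftCfg (((N * L ^ k : ℕ) : ℤ) • e i) W = W)
    {c : LSite d → 𝔸ˣ} (hcper : ∀ (z : LSite d) (i : Fin d), c (z + (N : ℤ) • e i) = c z)
    (x : LSite d) (i : Fin d) :
    (((pinnedGauge L U₀ k)⁻¹ * (fun x => c (flm L k x)) * pinnedGauge L U₀ k) * ptw L U₀ W k) (x + ((N * L ^ k : ℕ) : ℤ) • e i) =
      (((pinnedGauge L U₀ k)⁻¹ * (fun x => c (flm L k x)) * pinnedGauge L U₀ k) * ptw L U₀ W k) x := by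
  simp only [Pi.mul_apply, Pi.inv_apply]
  rw [ptw_periodic hL N k hU₀ hW, pinnedGauge_periodic hL N k hU₀, flm_add_mul_pow_smul hL, hcper]

end Zd

/-! ## §3 Setup torus: descent — an `SU(N)` gauge transformation with PRESCRIBED values at the `k`-centres carrying `W` into `Ax_k(𝔅_k, U₀)` -/

section Torus

open scoped Matrix.Norms.L2Operator
open B7Prop2SpecialUnitary (specialUnitaryUnits mem_specialUnitaryUnits)
open B7AvgClosedSpecialUnitarySharp (avgClosed_specialUnitary_of_le_twentyone)
open B15DeterminingSets (embIter)
open B10Eq27TorusAxialLog (transl pull pull_apply unitsField val_unitsField toUField suIncl val_suIncl)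
open B8Thm2SetupTorus (pullGauge pullGauge_apply toUGauge toUGauge_apply)
open Summit.QuantumFields.YangMills.Theorems.Prop7AxialReprPrint (embIter_eq_transl pull_toUField_mem pull_periodic_pow
  exists_su_gauge_of_periodic pull_toUField_gaugeAct)
open Summit.QuantumFields.YangMills.Theorems.Prop7FlatHolonomy (sitesPerDir_zero_eq_mul_pow)

variable {P : Params} {N : ℕ} [NeZero N]

omit [NeZero N] in
/-- `SU(N) → U(N) → (M_N)ˣ` is injective (same matrices). [cite: Balaban1985Averaging, (19) p.21] -/
theorem toUnits_suIncl_injective {g g' : Matrix.specialUnitaryGroup (Fin N) ℂ}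
    (h : Unitary.toUnits (suIncl g) = Unitary.toUnits (suIncl g')) : g = g' := by
  have h' := congrArg (fun u : (Matrix (Fin N) (Fin N) ℂ)ˣ => (u : Matrix (Fin N) (Fin N) ℂ)) h
  simp only [Unitary.val_toUnits_apply, val_suIncl] at h'
  exact Subtype.ext h'

/-- ★★★ **AXIAL GAUGE FIXING WITH PRESCRIBED VALUES AT THE `k`-CENTRES, AT THE SETUP-TORUS OBJECTS** ([Balaban1985RegularSpaces] p. 79 for the FULL gauge group, not only
the subgroup (1.14)).  For `SU(N)` (`N ≤ 21`) torus configurations `U₀`, `W` whose pullbacks based at `x₀ = embIter k 0` have `sup_p |·(∂p) − 1| < α·L^{−2k}` with `α`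
Prop.-1∕2-small (`C₀α ≤ ⅓`, `2α ≤ c₂′`), and for EVERY top datum `c : Site P k → SU(N)`, there is an `SU(N)` gauge transformation `u` of the torus with
**`u (embIter k y) = c y` at every `k`-centre** and `(W^u)♯_{x₀}` in the axial gauge (1.19) relative to `U₀♯_{x₀}` between ALL consecutive levels at every block of `ℤᵈ`.
Construction: `topData_global` for the based pullbacks with the `N_k`-periodic reading `c♯ z := c (z mod N_k)` of the datum, `topData_periodic` (period
`N_k·Lᵏ = sitesPerDir 0`), descent by `Prop7AxialReprPrint.exists_su_gauge_of_periodic`; the `k`-centres are `x₀ + Lᵏℤᵈ` (`embIter_eq_transl`).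
[cite: Balaban1985RegularSpaces, (1.19) p.79, p.79 (sentence after (1.20)), (1.3) p.77, (1.14) p.78; Balaban1985Variational, (4) p.278, (18) p.280] -/
theorem exists_gauge_topData_global (hN : N ≤ 21) {k : ℕ} (hk : k ≤ P.m + P.K) {α : ℝ} (hα : 0 < α)
    (hα3 : C0 P.d * α ≤ 1 / 3) (hα2 : 2 * α ≤ c2' P.d P.L)
    (U₀ W : GaugeField P 0 (Matrix.specialUnitaryGroup (Fin N) ℂ))
    (h33 : pdev (pull (unitsField (toUField U₀)) (embIter k (0 : Site P k))) < α * (((P.L : ℝ) ^ k)⁻¹) ^ 2)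
    (h34 : pdev (pull (unitsField (toUField W)) (embIter k (0 : Site P k))) < α * (((P.L : ℝ) ^ k)⁻¹) ^ 2)
    (c : Site P k → Matrix.specialUnitaryGroup (Fin N) ℂ) :
    ∃ u : GaugeTransf P 0 (Matrix.specialUnitaryGroup (Fin N) ℂ), (∀ y : Site P k, u (embIter k y) = c y) ∧
      (∀ n, n < k → ∀ (z : LSite P.d) (r : Fin P.d → Fin P.L),
        axialFn (avgIter P.L (pull (unitsField (toUField (GaugeField.gaugeAct u W))) (embIter k (0 : Site P k))) (k - (n + 1)))
            ((P.L : ℤ) • z) ((P.L : ℤ) • z + boxVec P.L r) =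
          axialFn (avgIter P.L (pull (unitsField (toUField U₀)) (embIter k (0 : Site P k))) (k - (n + 1)))
            ((P.L : ℤ) • z) ((P.L : ℤ) • z + boxVec P.L r)) := by
  letI : CStarAlgebra (Matrix (Fin N) (Fin N) ℂ) := B10Eq29TubeLine.cstarAlgebraMatrix N
  set x₀ : Site P 0 := embIter k (0 : Site P k) with hx₀
  have hL2 : 2 ≤ P.L := P.hL.2
  have hL1 : 1 ≤ P.L := le_trans (by norm_num) hL2
  have hG : AvgClosed P.d P.L (specialUnitaryUnits (Fin N)) := avgClosed_specialUnitary_of_le_twentyone hN P.d P.L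
  have hmem₀ : ∀ z κ, pull (unitsField (toUField U₀)) x₀ z κ ∈ specialUnitaryUnits (Fin N) := pull_toUField_mem U₀ x₀
  have hmem : ∀ z κ, pull (unitsField (toUField W)) x₀ z κ ∈ specialUnitaryUnits (Fin N) := pull_toUField_mem W x₀
  -- the `ℤᵈ` reading of the top datum: `c♯ z := c (z mod N_k)` in `(M_N)ˣ`, `N_k`-periodic and `SU(N)`-valued
  set cz : LSite P.d → (Matrix (Fin N) (Fin N) ℂ)ˣ :=
    fun z => Unitary.toUnits (suIncl (c (fun μ => ((z μ : ℤ) : ZMod (P.sitesPerDir k))))) with hcz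
  have hczG : ∀ z, cz z ∈ specialUnitaryUnits (Fin N) := fun z => by
    rw [mem_specialUnitaryUnits]; exact (c _).2
  have hczper : ∀ (z : LSite P.d) (i : Fin P.d), cz (z + ((P.sitesPerDir k : ℕ) : ℤ) • e i) = cz z := by
    intro z i
    have harg : (fun μ => (((z + ((P.sitesPerDir k : ℕ) : ℤ) • e i) μ : ℤ) : ZMod (P.sitesPerDir k))) =
        fun μ => ((z μ : ℤ) : ZMod (P.sitesPerDir k)) := by
      funext μ
      simp only [Pi.add_apply, Pi.smul_apply, smul_eq_mul, Int.cast_add, Int.cast_mul, Int.cast_natCast, ZMod.natCast_self,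
        zero_mul, add_zero]
    simp only [hcz, harg]
  obtain ⟨huG, -, htop, h19⟩ := topData_global P.L hL2 hG k _ _ hmem₀ hmem hα hα3 hα2 h33 h34 cz hczG
  have hper : ∀ (z : LSite P.d) (i : Fin P.d),
      (((pinnedGauge P.L (pull (unitsField (toUField U₀)) x₀) k)⁻¹ * (fun x => cz (flm P.L k x)) *
          pinnedGauge P.L (pull (unitsField (toUField U₀)) x₀) k) *
        ptw P.L (pull (unitsField (toUField U₀)) x₀) (pull (unitsField (toUField W)) x₀) k) (z + ((P.sitesPerDir 0 : ℕ) : ℤ) • e i) =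
      (((pinnedGauge P.L (pull (unitsField (toUField U₀)) x₀) k)⁻¹ * (fun x => cz (flm P.L k x)) *
          pinnedGauge P.L (pull (unitsField (toUField U₀)) x₀) k) *
        ptw P.L (pull (unitsField (toUField U₀)) x₀) (pull (unitsField (toUField W)) x₀) k) z := by
    intro z i
    rw [sitesPerDir_zero_eq_mul_pow hk]
    exact topData_periodic hL1 (P.sitesPerDir k) k (fun i => pull_periodic_pow hk _ x₀ i) (fun i => pull_periodic_pow hk _ x₀ i)
      (c := cz) hczper z i
  obtain ⟨v, hv⟩ := exists_su_gauge_of_periodic huG hper x₀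
  refine ⟨v, fun y => ?_, fun n hn z r => ?_⟩
  · have hy := congrFun hv (((P.L : ℤ) ^ k) • fun μ => (((y μ).val : ℕ) : ℤ))
    rw [pullGauge_apply, ← embIter_eq_transl hk y, htop] at hy
    have harg : (fun μ => (((((y μ).val : ℕ) : ℤ)) : ZMod (P.sitesPerDir k))) = y := by
      funext μ; simp only [Int.cast_natCast, ZMod.natCast_zmod_val]
    apply toUnits_suIncl_injective
    rw [← toUGauge_apply, hy]
    show Unitary.toUnits (suIncl (c fun μ => (((((y μ).val : ℕ) : ℤ)) : ZMod (P.sitesPerDir k)))) = _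
    rw [harg]
  · rw [pull_toUField_gaugeAct, hv]
    exact h19 n hn z r

/-- ★★★ The same, concluded in the CLASS form: `(W^u)♯ ∈ Ax_k(ℭ, U₀♯)` (`B8Eq119TwistedAxial.InAx`) for EVERY family `ℭ` of constraint sets, with `u (embIter k y) = c y` at every
`k`-centre (`inAx_of_global`).  For `c ≡ 1` this is `Prop7AxialReprPrint.exists_repr_inAx_based`. [cite: Balaban1985RegularSpaces, (1.19) p.79, (1.34) p.82; Balaban1985Variational, (18) p.280] -/
theorem exists_gauge_topData_inAx (hN : N ≤ 21) {k : ℕ} (hk : k ≤ P.m + P.K) {α : ℝ} (hα : 0 < α)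
    (hα3 : C0 P.d * α ≤ 1 / 3) (hα2 : 2 * α ≤ c2' P.d P.L)
    (U₀ W : GaugeField P 0 (Matrix.specialUnitaryGroup (Fin N) ℂ))
    (h33 : pdev (pull (unitsField (toUField U₀)) (embIter k (0 : Site P k))) < α * (((P.L : ℝ) ^ k)⁻¹) ^ 2)
    (h34 : pdev (pull (unitsField (toUField W)) (embIter k (0 : Site P k))) < α * (((P.L : ℝ) ^ k)⁻¹) ^ 2)
    (c : Site P k → Matrix.specialUnitaryGroup (Fin N) ℂ) :
    ∃ u : GaugeTransf P 0 (Matrix.specialUnitaryGroup (Fin N) ℂ), (∀ y : Site P k, u (embIter k y) = c y) ∧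
      ∀ Λ : ℕ → Set (LSite P.d), InAx P.L k Λ (pull (unitsField (toUField U₀)) (embIter k (0 : Site P k)))
        (pull (unitsField (toUField (GaugeField.gaugeAct u W))) (embIter k (0 : Site P k))) := by
  letI : CStarAlgebra (Matrix (Fin N) (Fin N) ℂ) := B10Eq29TubeLine.cstarAlgebraMatrix N
  obtain ⟨u, hu, h19⟩ := exists_gauge_topData_global hN hk hα hα3 hα2 U₀ W h33 h34 c
  exact ⟨u, hu, fun Λ => inAx_of_global h19 Λ⟩

end Torus

end Summit.QuantumFields.YangMills.Theorems.Prop7AxialResidualFreedom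

end
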